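import Mathlib
import Literature.Dynamics.Contraction.ComplexConeContraction

/-!
# Birkhoff's inequality and the extrema of `|·|` on Dubois' sets `E(x,y)`

Helper file for item stmt-CriticalPhenomena-8789 (`ComplexConeContraction`, route CardyComplexCone
of `CardyFormulaZ2`); everything here is independent of the matrices. Contents:

* `birkhoff_sqrt` — the real inequality at the heart of Birkhoff's / Dubois' contraction principle
  (Dubois 2009, end of the proof of Theorem 2.3, "at this point we are back to the case of the
  Hilbert metric"): if `0 < p ≤ P ≤ Q ≤ q`, `L ≥ 1` and `(q²−P²)(Q²−p²) ≤ L² (P²−p²)(q²−Q²)` then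
  `(Q−P)(q+p)(L+1) ≤ (L−1)(Q+P)(q−p)`, i.e. `tanh(d/4) ≤ tanh(Δ/4) tanh(D/4)` for `d = log(Q²/P²)`,
  `D = log(q²/p²)`, `e^{Δ/2} = L`, proved through the polynomial identity
  `(q²−P²)(Q²−p²)(qP−pQ)² − (q²−Q²)(P²−p²)(qQ−pP)² = (Q²−P²)(q²−p²)(PQ−pq)²` (no calculus);
* `cross_le_of_forall` — passage to the limit `m ↑ a`, `M ↓ b` in Dubois' inequality (2.13);
* `isCompact_duboisE`, `zero_not_mem_duboisE`, `exists_norm_bounds_duboisE` — for `x, y ∈ Int ℂⁿ₊`,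
  `n ≥ 1`, the set `E_{Int ℂⁿ₊}(x,y)` (a finite union of closed discs, Dubois' Lemma 3.2) is
  compact, misses `0`, and `|·|` attains its minimum `> 0` and its maximum on it;
* `sqrt_ratio_aux`, `final_arith` — bookkeeping inequalities for the contraction constants.

Reference: L. Dubois, *Projective metrics and contraction principles for complex cones*, J. London
Math. Soc. 79 (2009), Thm. 2.3; G. Birkhoff, Trans. AMS 85 (1957).
-/

open scoped ComplexConjugate
open Metric Set

namespace Summit.CriticalPhenomena.CardyFormulaZ2.Theorems.ComplexConeContraction

open Literature.Dynamics.Contraction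

/-! ### Birkhoff's inequality in square-root coordinates -/

/-- **Birkhoff's inequality** (the real computation ending the proof of Dubois 2009, Thm. 2.3), in
square-root coordinates `a = p², A = P², B = Q², b = q²`, `e^Δ = L²`: from
`(b−A)(B−a) ≤ e^Δ (A−a)(b−B)` one gets `tanh(d/4) ≤ tanh(Δ/4) tanh(D/4)`, written multiplicatively
as `(Q−P)(q+p)(L+1) ≤ (L−1)(Q+P)(q−p)`. -/
theorem birkhoff_sqrt {p P Q q L : ℝ} (hp : 0 < p) (hpP : p ≤ P) (hPQ : P ≤ Q) (hQq : Q ≤ q)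
    (hL : 1 ≤ L)
    (h : (q ^ 2 - P ^ 2) * (Q ^ 2 - p ^ 2) ≤ L ^ 2 * ((P ^ 2 - p ^ 2) * (q ^ 2 - Q ^ 2))) :
    (Q - P) * (q + p) * (L + 1) ≤ (L - 1) * ((Q + P) * (q - p)) := by
  have hP : 0 < P := lt_of_lt_of_le hp hpP
  have hQ : 0 < Q := lt_of_lt_of_le hP hPQ
  have hq : 0 < q := lt_of_lt_of_le hQ hQq
  by_cases hdeg : p < P ∧ Q < q
  · obtain ⟨hpP', hQq'⟩ := hdeg
    have hD : 0 < (P ^ 2 - p ^ 2) * (q ^ 2 - Q ^ 2) := mul_pos (by nlinarith) (by nlinarith)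
    have key1 : (q ^ 2 - Q ^ 2) * (P ^ 2 - p ^ 2) * (q * Q - p * P) ^ 2 ≤
        (q ^ 2 - P ^ 2) * (Q ^ 2 - p ^ 2) * (q * P - p * Q) ^ 2 := by
      have hid : (q ^ 2 - P ^ 2) * (Q ^ 2 - p ^ 2) * (q * P - p * Q) ^ 2 -
          (q ^ 2 - Q ^ 2) * (P ^ 2 - p ^ 2) * (q * Q - p * P) ^ 2 =
          (Q ^ 2 - P ^ 2) * (q ^ 2 - p ^ 2) * (P * Q - p * q) ^ 2 := by ring
      have hnn : 0 ≤ (Q ^ 2 - P ^ 2) * (q ^ 2 - p ^ 2) * (P * Q - p * q) ^ 2 :=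
        mul_nonneg (mul_nonneg (by nlinarith) (by nlinarith)) (sq_nonneg _)
      linarith
    have key2 : (q ^ 2 - P ^ 2) * (Q ^ 2 - p ^ 2) * (q * P - p * Q) ^ 2 ≤
        L ^ 2 * ((P ^ 2 - p ^ 2) * (q ^ 2 - Q ^ 2)) * (q * P - p * Q) ^ 2 :=
      mul_le_mul_of_nonneg_right h (sq_nonneg _)
    have key3 : (q * Q - p * P) ^ 2 ≤ (L * (q * P - p * Q)) ^ 2 := by
      have h' : (P ^ 2 - p ^ 2) * (q ^ 2 - Q ^ 2) * (q * Q - p * P) ^ 2 ≤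
          (P ^ 2 - p ^ 2) * (q ^ 2 - Q ^ 2) * (L * (q * P - p * Q)) ^ 2 :=
        calc (P ^ 2 - p ^ 2) * (q ^ 2 - Q ^ 2) * (q * Q - p * P) ^ 2
            = (q ^ 2 - Q ^ 2) * (P ^ 2 - p ^ 2) * (q * Q - p * P) ^ 2 := by ring
          _ ≤ L ^ 2 * ((P ^ 2 - p ^ 2) * (q ^ 2 - Q ^ 2)) * (q * P - p * Q) ^ 2 := key1.trans key2
          _ = (P ^ 2 - p ^ 2) * (q ^ 2 - Q ^ 2) * (L * (q * P - p * Q)) ^ 2 := by ring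
      exact le_of_mul_le_mul_left h' hD
    have hqP : 0 ≤ q * P - p * Q := by nlinarith
    have key4 : q * Q - p * P ≤ L * (q * P - p * Q) :=
      (pow_le_pow_iff_left₀ (by nlinarith) (mul_nonneg (by linarith) hqP) two_ne_zero).1 key3
    linarith
  · -- degenerate cases `p = P` or `Q = q`: then in fact `Q = P`
    have hprod : (q ^ 2 - P ^ 2) * (Q ^ 2 - p ^ 2) ≤ 0 := by
      rcases not_and_or.1 hdeg with h1 | h1
      · have hPp : P = p := le_antisymm (not_lt.1 h1) hpP
        have h0 : P ^ 2 - p ^ 2 = 0 := by rw [hPp]; ring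
        rw [h0, zero_mul, mul_zero] at h
        exact h
      · have hqQ : q = Q := le_antisymm (not_lt.1 h1) hQq
        have h0 : q ^ 2 - Q ^ 2 = 0 := by rw [hqQ]; ring
        rw [h0, mul_zero, mul_zero] at h
        exact h
    have h2 : 0 ≤ q ^ 2 - P ^ 2 := by nlinarith
    have h3 : 0 ≤ Q ^ 2 - p ^ 2 := by nlinarith
    have h4 : (q ^ 2 - P ^ 2) * (Q ^ 2 - p ^ 2) = 0 := le_antisymm hprod (mul_nonneg h2 h3)
    have hQP : Q = P := by
      rcases mul_eq_zero.1 h4 with h5 | h5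
      · have : q = P := (pow_left_inj₀ hq.le hP.le two_ne_zero).1 (by linarith)
        linarith
      · have : Q = p := (pow_left_inj₀ hQ.le hp.le two_ne_zero).1 (by linarith)
        linarith
    rw [hQP, sub_self, zero_mul, zero_mul]
    exact mul_nonneg (by linarith) (mul_nonneg (by linarith) (by linarith))

/-- Passage to the limit `m ↑ a`, `M ↓ b` in Dubois' inequality (2.13): a polynomial inequality
valid for all `0 < m < a` and `M > b` persists at `(m, M) = (a, b)`. -/
theorem cross_le_of_forall {a b A B Λ : ℝ} (ha : 0 < a)
    (h : ∀ m M : ℝ, 0 < m → m < a → b < M → (M - A) * (B - m) ≤ Λ * ((A - m) * (M - B))) :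
    (b - A) * (B - a) ≤ Λ * ((A - a) * (b - B)) := by
  have hmem : (a, b) ∈ closure (Ioo (0 : ℝ) a ×ˢ Ioi b) := by
    rw [closure_prod_eq, closure_Ioo ha.ne, closure_Ioi]
    exact Set.mem_prod.2 ⟨Set.mem_Icc.2 ⟨ha.le, le_rfl⟩, Set.mem_Ici.2 le_rfl⟩
  exact le_on_closure (f := fun x : ℝ × ℝ => (x.2 - A) * (B - x.1))
    (g := fun x : ℝ × ℝ => Λ * ((A - x.1) * (x.2 - B)))
    (fun x hx => h x.1 x.2 hx.1.1 hx.1.2 hx.2) (by fun_prop) (by fun_prop) hmem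

/-! ### The set `E_{Int ℂⁿ₊}(x, y)` for `x, y ∈ Int ℂⁿ₊` -/

/-- `E_{Int ℂⁿ₊}(x,y)` is compact for `x ∈ Int ℂⁿ₊` (a finite union of closed discs, Lemma 3.2). -/
theorem isCompact_duboisE {n : ℕ} {x : Fin n → ℂ} (hx : x ∈ rughConeInt n) (y : Fin n → ℂ) :
    IsCompact (duboisE (rughConeInt n) x y) := by
  rw [duboisE_rughConeInt_eq_iUnion hx]
  exact isCompact_iUnion fun k => isCompact_iUnion fun l => isCompact_closedBall _ _

/-- `0 ∉ E_{Int ℂⁿ₊}(x,y)` when `y ∈ Int ℂⁿ₊` (indeed `0 · x − y = −y ∈ Int ℂⁿ₊`). -/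
theorem zero_not_mem_duboisE {n : ℕ} (x : Fin n → ℂ) {y : Fin n → ℂ} (hy : y ∈ rughConeInt n) :
    (0 : ℂ) ∉ duboisE (rughConeInt n) x y := by
  simp only [duboisE, mem_setOf_eq, zero_smul, zero_sub, not_not]
  intro k l
  simpa using hy k l

/-- For `x, y ∈ Int ℂⁿ₊` (`n ≥ 1`) the modulus attains on `E_{Int ℂⁿ₊}(x,y)` a minimum `|α| > 0` and
a maximum `|β|`: `E ⊆ {|α| ≤ |z| ≤ |β|}` with `α, β ∈ E` (so `a = inf |E| = |α|`,
`b = sup |E| = |β|` in Dubois' Definition 2). -/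
theorem exists_norm_bounds_duboisE {n : ℕ} (hn : 0 < n) {x y : Fin n → ℂ} (hx : x ∈ rughConeInt n)
    (hy : y ∈ rughConeInt n) :
    ∃ α ∈ duboisE (rughConeInt n) x y, ∃ β ∈ duboisE (rughConeInt n) x y, 0 < ‖α‖ ∧
      ∀ z ∈ duboisE (rughConeInt n) x y, ‖α‖ ≤ ‖z‖ ∧ ‖z‖ ≤ ‖β‖ := by
  have hK := isCompact_duboisE hx y
  have hne : (duboisE (rughConeInt n) x y).Nonempty := ⟨_, div_mem_duboisE_rughConeInt hx y ⟨0, hn⟩⟩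
  obtain ⟨α, hα, hαmin⟩ := hK.exists_isMinOn hne continuous_norm.continuousOn
  obtain ⟨β, hβ, hβmax⟩ := hK.exists_isMaxOn hne continuous_norm.continuousOn
  refine ⟨α, hα, β, hβ, ?_, fun z hz => ⟨hαmin hz, hβmax hz⟩⟩
  exact norm_pos_iff.2 fun h => zero_not_mem_duboisE x hy (h ▸ hα)

/-! ### Bookkeeping for the constants -/

/-- From `b ≤ L² a` (`L ≥ 0`): `(√b − √a)(L+1) ≤ (L−1)(√b + √a)`, i.e.
`tanh(log(b/a)/4) ≤ (L−1)/(L+1)`. -/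
theorem sqrt_ratio_aux {a b L : ℝ} (hL : 0 ≤ L) (h : b ≤ L ^ 2 * a) :
    (Real.sqrt b - Real.sqrt a) * (L + 1) ≤ (L - 1) * (Real.sqrt b + Real.sqrt a) := by
  have h1 : Real.sqrt b ≤ L * Real.sqrt a := by
    calc Real.sqrt b ≤ Real.sqrt (L ^ 2 * a) := Real.sqrt_le_sqrt h
      _ = L * Real.sqrt a := by rw [Real.sqrt_mul (sq_nonneg _), Real.sqrt_sq hL]
  have _ := Real.sqrt_nonneg a
  linarith

/-- Final arithmetic: if `0 < p ≤ q`, `q − p ≤ t (q + p)` with `0 ≤ t ≤ c < 1`, then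
`3 (q² − p²) (1 − c)² ≤ 12 t p²` (so that `3 (b/a − 1) ≤ 12 t / (1−c)²` for `a = p²`, `b = q²`). -/
theorem final_arith {p q t c : ℝ} (hp : 0 < p) (hpq : p ≤ q) (ht0 : 0 ≤ t) (htc : t ≤ c)
    (hc1 : c < 1) (h : q - p ≤ t * (q + p)) :
    3 * (q ^ 2 - p ^ 2) * (1 - c) ^ 2 ≤ 12 * t * p ^ 2 := by
  have hqp : 0 < q + p := by linarith
  have h1 : (q + p) * (1 - t) ≤ 2 * p := by nlinarith
  have h2 : (q + p) * (1 - c) ≤ 2 * p := by nlinarith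
  have hX : 0 ≤ (q + p) * (1 - c) := by nlinarith
  have h4 : (q + p) ^ 2 * (1 - c) ^ 2 ≤ 4 * p ^ 2 := by
    nlinarith [mul_le_mul h2 h2 hX (by linarith)]
  have h3 : q ^ 2 - p ^ 2 ≤ t * (q + p) ^ 2 := by nlinarith
  calc 3 * (q ^ 2 - p ^ 2) * (1 - c) ^ 2 ≤ 3 * (t * (q + p) ^ 2) * (1 - c) ^ 2 :=
        mul_le_mul_of_nonneg_right (by linarith) (sq_nonneg _)
    _ = 3 * t * ((q + p) ^ 2 * (1 - c) ^ 2) := by ring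
    _ ≤ 3 * t * (4 * p ^ 2) := mul_le_mul_of_nonneg_left h4 (by positivity)
    _ = 12 * t * p ^ 2 := by ring

end Summit.CriticalPhenomena.CardyFormulaZ2.Theorems.ComplexConeContraction
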